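import Literature.AlgebraicGeometry.Morphisms.SectionsBaseChangeOfFibreVanishingPoints
import Literature.AlgebraicGeometry.Morphisms.ProperPushforwardCoh
import HarnessLib

/-!
# The base-change morphism `b^*(p_* G) ⟶ (p_T)_*(pr^* G)` is an isomorphism, from fibrewise `H¹`-vanishing

[cite: MumfordAV1970, §5, Corollary 3 (p. 53)]
[cite: Hartshorne1977, III Theorem 12.11 (p. 290)]
[cite: Hartshorne1977, III Prop. 9.3]

The consumer head of the (h2) chain «cohomology and base change in degree `0`» for the base-change morphism
`β : b^*(p_* G) ⟶ (p_T)_*(pr^* G)` of ★ `Modules/PushforwardBaseChangeHom` (the `(hbc)` input of ★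
`Morphisms/ContainmentRepOfPushforward`): for `p : X → Spec A` PROPER and FLAT over an affine noetherian base, `G` finite
locally free on `X` with `Ext¹(𝒪_{X_y}, G|_{X_y}) = 0` on every scheme-theoretic fibre `X_y = p.fiber y` (`y` a point of
`Spec A`), and ANY cartesian square `X_T = X ×_A T → T`, **`β` is an isomorphism**
(`isIso_pushforwardBaseChangeHom_of_forall_fiber`).  Assembly of ★ B-p04 (g19)'s
`Modules.isIso_pushforwardBaseChangeHom_of_forall_bijective_top` (affine base, chart criterion on the affine opens of `T`),
★ `exists_tensor_pushforward_linearEquiv_of_forall_fiber` (the chart clause from fibrewise vanishing) and ★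
`isAffineLocalizing_pushforward` (`p_* G` is affine-localizing: `X` is a Noetherian scheme).  Also the prime-indexed form
`isIso_pushforwardBaseChangeHom_of_forall_prime` (fibre squares chosen by the consumer, as in ★ G8/G9).  Theorems only;
no instance, notation, named fact.  Universe `Scheme.{0}`.  Cell `hodgecm-mathlib`, F-DAG (h2) → (h6-d) (B-p19 (g15));
the general (locally noetherian, non-affine) base is B-p04 (g19)'s Zariski localisation `Modules/PushforwardBaseChangeRestrictBase`.
HC_CM is proved only modulo the 7 printed citations until rung 0 closes — nothing here bears on a summit statement.

## References

* D. Mumford, *Abelian Varieties*, TIFR Studies in Mathematics 5 (1970), §5, Cor. 3 (p. 53). [MumfordAV1970]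
* R. Hartshorne, *Algebraic Geometry*, GTM 52 (1977), III Thm. 12.11 (p. 290), III Prop. 9.3. [Hartshorne1977]
-/

noncomputable section

set_option backward.isDefEq.respectTransparency false

open CategoryTheory CategoryTheory.Limits CategoryTheory.Abelian Opposite TopologicalSpace AlgebraicGeometry
open TensorProduct

namespace Literature.AlgebraicGeometry.Modules

open Literature.AlgebraicGeometry.Morphisms Literature.AlgebraicGeometry.HodgeTheory Literature.AlgebraicGeometry.Motives

section IsoOfFibreVanishing

/-- `p_* G` is affine-localizing for `p : X → Spec A` proper with `A` noetherian and `G` finite locally free (`X` is a Noetherian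
scheme; ★ `isAffineLocalizing_pushforward`). [cite: Hartshorne1977, II Prop. 5.8 (c) (p. 115)] -/
theorem isAffineLocalizing_pushforward_of_isProper {A : Type} [CommRing A] [IsNoetherianRing A] {X : Scheme.{0}}
    (p : X ⟶ Spec (CommRingCat.of A)) [IsProper p] (G : X.Modules) (hL : IsFiniteLocallyFree G) :
    IsAffineLocalizing ((Scheme.Modules.pushforward p).obj G) := by
  haveI := hL.isVectorBundle.1
  haveI : IsLocallyNoetherian X := LocallyOfFiniteType.isLocallyNoetherian p
  haveI : CompactSpace X := QuasiCompact.compactSpace_of_compactSpace p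
  haveI : IsNoetherian X := { }
  exact isAffineLocalizing_pushforward p (IsAffineLocalizing.of_isQuasicoherent G)

/-- **`β : b^*(p_* G) ⟶ (p_T)_*(pr^* G)` IS AN ISOMORPHISM, from fibrewise `H¹`-vanishing, prime-indexed fibre data**
(★ `isIso_pushforwardBaseChangeHom_of_forall_bijective_top` + ★ `exists_tensor_pushforward_linearEquiv_of_forall_prime`):
`p : X → Spec A` proper flat, `A` noetherian, `G` finite locally free with `Ext¹(𝒪_{X_𝔭}, G|_{X_𝔭}) = 0` for the consumer's
fibre squares `HX 𝔭` at every prime, and `H : IsPullback pr p_T p b` any cartesian square.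
[cite: MumfordAV1970, §5 Cor. 3 (p. 53)] [cite: Hartshorne1977, III Thm. 12.11 (p. 290)] [cite: Hartshorne1977, III Prop. 9.3 (proof)] -/
theorem isIso_pushforwardBaseChangeHom_of_forall_prime {A : Type} [CommRing A] [IsNoetherianRing A] {X : Scheme.{0}}
    (p : X ⟶ Spec (CommRingCat.of A)) [IsProper p] [Flat p] (G : X.Modules) (hL : IsFiniteLocallyFree G)
    {X₀ : ∀ (𝔭 : Ideal A) [𝔭.IsPrime], Scheme.{0}} (iX : ∀ (𝔭 : Ideal A) [𝔭.IsPrime], X₀ 𝔭 ⟶ X)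
    (f₀ : ∀ (𝔭 : Ideal A) [𝔭.IsPrime], X₀ 𝔭 ⟶ Spec (CommRingCat.of 𝔭.ResidueField))
    (HX : ∀ (𝔭 : Ideal A) [𝔭.IsPrime],
      IsPullback (iX 𝔭) (f₀ 𝔭) p (Spec.map (CommRingCat.ofHom (algebraMap A 𝔭.ResidueField))))
    (hvan : ∀ (𝔭 : Ideal A) [𝔭.IsPrime],
      Subsingleton (Ext.{1} (unitModule (X₀ 𝔭)) ((Scheme.Modules.pullback (iX 𝔭)).obj G) 1))
    {T XT : Scheme.{0}} {pr : XT ⟶ X} {pT : XT ⟶ T} {b : T ⟶ Spec (CommRingCat.of A)}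
    (H : IsPullback pr pT p b) :
    IsIso (pushforwardBaseChangeHom H.w G) :=
  isIso_pushforwardBaseChangeHom_of_forall_bijective_top H.w G (isAffineLocalizing_pushforward_of_isProper p G hL)
    fun W hW => (exists_tensor_pushforward_linearEquiv_of_forall_prime p G hL iX f₀ HX hvan H W hW).2

/-- **`β : b^*(p_* G) ⟶ (p_T)_*(pr^* G)` IS AN ISOMORPHISM, from `H¹`-vanishing on the scheme-theoretic fibres `p.fiber y`**
(Mumford §5 Cor. 3 / Hartshorne III 12.11 in degree `0`, as the (hbc) binder of the (h6-d) chain): `p : X → Spec A` proper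
flat, `A` noetherian, `G` finite locally free with `Ext¹(𝒪_{X_y}, (p.fiberι y)^* G) = 0` for every point `y` of `Spec A`,
`H : IsPullback pr p_T p b` ANY cartesian square (`b : T → Spec A`, any scheme `T`).
[cite: MumfordAV1970, §5 Cor. 3 (p. 53)] [cite: Hartshorne1977, III Thm. 12.11 (p. 290)] [cite: Hartshorne1977, III Prop. 9.3 (proof)] -/
theorem isIso_pushforwardBaseChangeHom_of_forall_fiber {A : Type} [CommRing A] [IsNoetherianRing A] {X : Scheme.{0}}
    (p : X ⟶ Spec (CommRingCat.of A)) [IsProper p] [Flat p] (G : X.Modules) (hL : IsFiniteLocallyFree G)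
    (hvan : ∀ y : Spec (CommRingCat.of A),
      Subsingleton (Ext.{1} (unitModule (p.fiber y)) ((Scheme.Modules.pullback (p.fiberι y)).obj G) 1))
    {T XT : Scheme.{0}} {pr : XT ⟶ X} {pT : XT ⟶ T} {b : T ⟶ Spec (CommRingCat.of A)}
    (H : IsPullback pr pT p b) :
    IsIso (pushforwardBaseChangeHom H.w G) :=
  isIso_pushforwardBaseChangeHom_of_forall_bijective_top H.w G (isAffineLocalizing_pushforward_of_isProper p G hL)
    fun W hW => (exists_tensor_pushforward_linearEquiv_of_forall_fiber p G hL hvan H W hW).2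

end IsoOfFibreVanishing

end Literature.AlgebraicGeometry.Modules

end
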